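import Summits.BirchSwinnertonDyer.BirchSwinnertonDyer.Theorems.CumulativeHeegnerLeopoldtEisensteinCharacterInvariantsAtThreeAlgebraicHalfOfResidualFinite
import Summits.BirchSwinnertonDyer.BirchSwinnertonDyer.Theorems.CumulativeHeegnerLeopoldtCumulativeHeegnerInclusionAtThreeB1OfPrint
import Summits.BirchSwinnertonDyer.BirchSwinnertonDyer.Theorems.CumulativeHeegnerLeopoldtCumulativeHeegnerInclusionAtThreeLineDeterminantAtThree
import Summits.BirchSwinnertonDyer.BirchSwinnertonDyer.Theorems.CumulativeHeegnerLeopoldtCumulativeHeegnerInclusionAtThreeBadPlacesSplitFinite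
import Summits.BirchSwinnertonDyer.BirchSwinnertonDyer.Theorems.EisensteinPrimesGoodLatticeOmegaPrelims
import Summits.BirchSwinnertonDyer.Rank1Residual.Partition.AnticyclotomicControlJSWEmbAt
import HarnessLib

/-!
# Route `CumulativeHeegnerLeopoldt`, crux K2 `EisensteinCharacterInvariantsAtThree` (stmt-BirchSwinnertonDyer-24199):
# [ALG] SPLIT — its torsion / `μ = 0` half is PRINT (B1), only the λ-FORMULA is a port (helper, `--supports 24199`)

Lead prover `bsd-line-chl-p1` g9. The K2 line's stub [ALG] `stub_algLambda` (binder type `halg` of p614352 / p681722: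
Castella–Grossi–Lee–Skinner 2022 Thm. 1.5.1 SHAPE on the Leopoldt cell) concludes a conjunction of FOUR statements
about `𝔛 = X_{∅,0}(𝔭′)`: (i) finitely generated, (ii) `Λ`-torsion, (iii) `μ(𝔛) = 0`, (iv) the λ-formula
`λ(𝔛) + Σ_{w∣N} λ𝒫_w(f) = λ(𝔛_{θsub}) + λ(𝔛_{θquot}) + Σ_{w∣N}(λ𝒫_w(θsub) + λ𝒫_w(θquot))`. Parts (i)–(iii) are NOT
port work: they follow from the route's PRINT item 26897 (CGLS22 Prop. 14) through B1 (K1 lineage, p616187 parts) and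
Greenberg's criterion (p609299 `isTorsion_and_muInvariant_eq_zero_of_residualFinite`; finiteness is the tree's
`XAc.module_finite`). This file proves `halg` from the print fact and the λ-FORMULA ALONE
(`algLambda_of_print_of_formula`), so the line's port stub shrinks to CGLS Thm. 1.5.1's equation (iv) — Prop.
1.4.1/1.4.2 (the residual exact sequences along `0 → 𝔽(φ) → E[3] → 𝔽(ψ) → 0`), Cor. 1.4.3 (no finite
`Λ`-submodules ⇒ `λ = dim_𝔽 Sel[𝔭]`), and the imprimitive bookkeeping — exactly the part of §1 of CGLS not yet ported.
THEOREMS ONLY (no `def`, no `sorry`); CONDITIONAL on the displayed `hP` (print) and `hform` (port); closes nothing.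
BSD is not proved for any curve by any of this.
References: [CastellaGrossiLeeSkinner2022] §1.2 Prop. 14, Props. 1.4.1–1.4.2, Cor. 1.4.3, Thm. 1.5.1
(arXiv:2008.02571v2); [GreenbergLNM1716] §1 p. 60.
-/

set_option autoImplicit false
-- `…BirchSwinnertonDyer.BirchSwinnertonDyer.Theorems…` is the problem's mandated namespace (D-0017).
set_option linter.dupNamespace false

noncomputable section

open scoped Classical

namespace Summit.BirchSwinnertonDyer.BirchSwinnertonDyer.Theorems.EisensteinCharacterInvariantsAtThreeAlgSplit

open PowerSeries WeierstrassCurve NumberField IsDedekindDomain Field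
  Literature.NumberTheory.EllipticCurves Literature.NumberTheory.EllipticCurves.ModularForms
  Literature.NumberTheory.EllipticCurves.Rank1Residual
  Literature.NumberTheory.EllipticCurves.KellerYin2024
  Literature.NumberTheory.GaloisRepresentations
  Summit.BirchSwinnertonDyer.Rank1Residual
  Summit.BirchSwinnertonDyer.Rank1Residual.X11b.AcSelmer
  Summit.BirchSwinnertonDyer.Rank1Residual.X1.KellerYinMuLambdaSplit

/-- **[ALG] from PRINT + the λ-formula.** `hP` = the route's print item 26897 (CGLS22 Prop. 14, Literature named fact —
unproved published input); `hform` = the λ-formula (iv) of CGLS Thm. 1.5.1 on the Leopoldt cell with the binders of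
`halg` VERBATIM (print modulo port). Conclusion = `halg` of p614352 / p681722 VERBATIM (`𝔛` finitely generated,
torsion, `μ = 0`, and the formula): (i) `XAc.module_finite`; (ii)–(iii) print ⟹ B1 ⟹ Greenberg's criterion
(p609299). CONDITIONAL; closes nothing.
[cite: CastellaGrossiLeeSkinner2022, §1.2 Prop. 14 and Thm. 1.5.1] [cite: GreenbergLNM1716, §1 p. 60] -/
theorem algLambda_of_print_of_formula
    (hP : Literature.NumberTheory.EllipticCurves.CastellaGrossiLeeSkinner2022.prop14_residualCharacterSelmer_finite)
    (hform : ∀ (W : WeierstrassCurve ℚ) [W.IsElliptic] [W.IsGloballyMinimal] (N : ℕ) [NeZero N] (K : Type) [Field K] [NumberField K], Summit.BirchSwinnertonDyer.Rank1Residual.Additive.ClassO6 W 3 → Literature.NumberTheory.EllipticCurves.Rank1Residual.Red W 3 → (∃ Φ : AddSubgroup (WeierstrassCurve.geomTorsion W ((3 : ℕ) : ℤ)), Literature.NumberTheory.EllipticCurves.Rank1Residual.IsRationalLine W 3 Φ ∧ ∀ (v : IsDedekindDomain.HeightOneSpectrum (NumberField.RingOfIntegers ℚ)), ((3 : ℕ)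 : NumberField.RingOfIntegers ℚ) ∈ v.asIdeal → ∀ 𝔓 ∈ v.primesAbove, ¬ (∀ g ∈ 𝔓.decompositionSubgroup (Field.absoluteGaloisGroup ℚ), ∀ P ∈ Φ, g • P = P) ∧ ¬ (∀ g ∈ 𝔓.decompositionSubgroup (Field.absoluteGaloisGroup ℚ), ∀ P : WeierstrassCurve.geomTorsion W ((3 : ℕ) : ℤ), g • P - P ∈ Φ)) → W.conductorNorm ℤ = N → Literature.NumberTheory.EllipticCurves.IsImaginaryQuadratic K → Literature.NumberTheory.EllipticCurves.SatisfiesHeegnerHypothesis N K → Odd (NumberField.discr K) → (∀ Q : (W.baseChange K).toAffine.Point, (3 : ℕ) • Q = 0 → Q = 0) → ∀ (κ : Literature.NumberTheory.EllipticCurves.ZpExtension K 3), κ.IsAnticyclotomic → ∀ (γ : Field.absoluteGaloisGroup K) [Fact (κ.IsTopGenerator γ)] (𝔭 : IsDedekindDomain.HeightOneSpectrum (NumberField.RingOfIntegers K)), ((3 : ℕ) : NumberField.RingOfIntegers K) ∈ 𝔭.asIdeal → 𝔭.asIdeal.ramificationIdx (NumberField.RingOfIntegers ℚ) = 1 → 𝔭.asIdeal.inertiaDeg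 (NumberField.RingOfIntegers ℚ) = 1 → ∀ (𝔭' : IsDedekindDomain.HeightOneSpectrum (NumberField.RingOfIntegers K)), ((3 : ℕ) : NumberField.RingOfIntegers K) ∈ 𝔭'.asIdeal → 𝔭' ≠ 𝔭 → ∀ (θsub θquot : FramedGaloisRep K (padicCoeffIntegers (∅ : Set (PadicAlgCl 3))) 1), Literature.NumberTheory.EllipticCurves.KellerYin2024.IsResidualPairOver (W.baseChange K) 3 θsub θquot → ∀ (Sf : Finset (IsDedekindDomain.HeightOneSpectrum (NumberField.RingOfIntegers K))), (∀ w : IsDedekindDomain.HeightOneSpectrum (NumberField.RingOfIntegers K), w ∈ Sf ↔ ((W.conductorNorm ℤ : ℤ) : NumberField.RingOfIntegers K) ∈ w.asIdeal) → ∀ (Dsub : Literature.NumberTheory.EllipticCurves.GreenbergVatsal2000.DatumDualData κ γ (Literature.NumberTheory.EllipticCurves.KellerYin2024.charModule (∅ : Set (PadicAlgCl 3)) θsub) (Literature.NumberTheory.EllipticCurves.Castella2018.AcSelmer.bdpData (Literature.NumberTheory.EllipticCurves.KellerYin2024.charModule (∅ : Set (PadicAlgCl 3)) θsub) 3 𝔭')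 ∅) (Dquot : Literature.NumberTheory.EllipticCurves.GreenbergVatsal2000.DatumDualData κ γ (Literature.NumberTheory.EllipticCurves.KellerYin2024.charModule (∅ : Set (PadicAlgCl 3)) θquot) (Literature.NumberTheory.EllipticCurves.Castella2018.AcSelmer.bdpData (Literature.NumberTheory.EllipticCurves.KellerYin2024.charModule (∅ : Set (PadicAlgCl 3)) θquot) 3 𝔭') ∅), Literature.NumberTheory.EllipticCurves.lambdaInvariant 3 (Summit.BirchSwinnertonDyer.Rank1Residual.X11b.AcSelmer.XAc (W.baseChange K) 3 κ 𝔭' ∅ γ) + ∑ w ∈ Sf, Literature.NumberTheory.EllipticCurves.KellerYin2024.curveLocalLambda κ (W.baseChange K) w = Literature.NumberTheory.EllipticCurves.lambdaInvariant 3 Dsub.X + Literature.NumberTheory.EllipticCurves.lambdaInvariant 3 Dquot.X + ∑ w ∈ Sf, (Literature.NumberTheory.EllipticCurves.KellerYin2024.charLocalLambda (∅ : Set (PadicAlgCl 3)) κ θsub w + Literature.NumberTheory.EllipticCurves.KellerYin2024.charLocalLambda (∅ : Set (PadicAlgCl 3)) κ θquot w)) :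
    ∀ (W : WeierstrassCurve ℚ) [W.IsElliptic] [W.IsGloballyMinimal] (N : ℕ) [NeZero N] (K : Type) [Field K] [NumberField K], Summit.BirchSwinnertonDyer.Rank1Residual.Additive.ClassO6 W 3 → Literature.NumberTheory.EllipticCurves.Rank1Residual.Red W 3 → (∃ Φ : AddSubgroup (WeierstrassCurve.geomTorsion W ((3 : ℕ) : ℤ)), Literature.NumberTheory.EllipticCurves.Rank1Residual.IsRationalLine W 3 Φ ∧ ∀ (v : IsDedekindDomain.HeightOneSpectrum (NumberField.RingOfIntegers ℚ)), ((3 : ℕ) : NumberField.RingOfIntegers ℚ) ∈ v.asIdeal → ∀ 𝔓 ∈ v.primesAbove, ¬ (∀ g ∈ 𝔓.decompositionSubgroup (Field.absoluteGaloisGroup ℚ), ∀ P ∈ Φ, g • P = P) ∧ ¬ (∀ g ∈ 𝔓.decompositionSubgroup (Field.absoluteGaloisGroup ℚ), ∀ P : WeierstrassCurve.geomTorsion W ((3 : ℕ) : ℤ), g • P - P ∈ Φ)) → W.conductorNorm ℤ = N → Literature.NumberTheory.EllipticCurves.IsImaginaryQuadratic K → Literature.NumberTheory.EllipticCurves.SatisfiesHeegnerHypothesis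 N K → Odd (NumberField.discr K) → (∀ Q : (W.baseChange K).toAffine.Point, (3 : ℕ) • Q = 0 → Q = 0) → ∀ (κ : Literature.NumberTheory.EllipticCurves.ZpExtension K 3), κ.IsAnticyclotomic → ∀ (γ : Field.absoluteGaloisGroup K) [Fact (κ.IsTopGenerator γ)] (𝔭 : IsDedekindDomain.HeightOneSpectrum (NumberField.RingOfIntegers K)), ((3 : ℕ) : NumberField.RingOfIntegers K) ∈ 𝔭.asIdeal → 𝔭.asIdeal.ramificationIdx (NumberField.RingOfIntegers ℚ) = 1 → 𝔭.asIdeal.inertiaDeg (NumberField.RingOfIntegers ℚ) = 1 → ∀ (𝔭' : IsDedekindDomain.HeightOneSpectrum (NumberField.RingOfIntegers K)), ((3 : ℕ) : NumberField.RingOfIntegers K) ∈ 𝔭'.asIdeal → 𝔭' ≠ 𝔭 → ∀ (θsub θquot : FramedGaloisRep K (padicCoeffIntegers (∅ : Set (PadicAlgCl 3))) 1), Literature.NumberTheory.EllipticCurves.KellerYin2024.IsResidualPairOver (W.baseChange K) 3 θsub θquot → ∀ (Sf : Finset (IsDedekindDomain.HeightOneSpectrum (NumberField.RingOfIntegers K))),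 (∀ w : IsDedekindDomain.HeightOneSpectrum (NumberField.RingOfIntegers K), w ∈ Sf ↔ ((W.conductorNorm ℤ : ℤ) : NumberField.RingOfIntegers K) ∈ w.asIdeal) → ∀ (Dsub : Literature.NumberTheory.EllipticCurves.GreenbergVatsal2000.DatumDualData κ γ (Literature.NumberTheory.EllipticCurves.KellerYin2024.charModule (∅ : Set (PadicAlgCl 3)) θsub) (Literature.NumberTheory.EllipticCurves.Castella2018.AcSelmer.bdpData (Literature.NumberTheory.EllipticCurves.KellerYin2024.charModule (∅ : Set (PadicAlgCl 3)) θsub) 3 𝔭') ∅) (Dquot : Literature.NumberTheory.EllipticCurves.GreenbergVatsal2000.DatumDualData κ γ (Literature.NumberTheory.EllipticCurves.KellerYin2024.charModule (∅ : Set (PadicAlgCl 3)) θquot) (Literature.NumberTheory.EllipticCurves.Castella2018.AcSelmer.bdpData (Literature.NumberTheory.EllipticCurves.KellerYin2024.charModule (∅ : Set (PadicAlgCl 3)) θquot) 3 𝔭') ∅), Module.Finite (Literature.NumberTheory.EllipticCurves.IwasawaAlgebra 3) (Summit.BirchSwinnertonDyer.Rank1Residual.X11b.AcSelmer.XAc (W.baseChange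 K) 3 κ 𝔭' ∅ γ) ∧ Module.IsTorsion (Literature.NumberTheory.EllipticCurves.IwasawaAlgebra 3) (Summit.BirchSwinnertonDyer.Rank1Residual.X11b.AcSelmer.XAc (W.baseChange K) 3 κ 𝔭' ∅ γ) ∧ Literature.NumberTheory.EllipticCurves.muInvariant 3 (Summit.BirchSwinnertonDyer.Rank1Residual.X11b.AcSelmer.XAc (W.baseChange K) 3 κ 𝔭' ∅ γ) = 0 ∧ Literature.NumberTheory.EllipticCurves.lambdaInvariant 3 (Summit.BirchSwinnertonDyer.Rank1Residual.X11b.AcSelmer.XAc (W.baseChange K) 3 κ 𝔭' ∅ γ) + ∑ w ∈ Sf, Literature.NumberTheory.EllipticCurves.KellerYin2024.curveLocalLambda κ (W.baseChange K) w = Literature.NumberTheory.EllipticCurves.lambdaInvariant 3 Dsub.X + Literature.NumberTheory.EllipticCurves.lambdaInvariant 3 Dquot.X + ∑ w ∈ Sf, (Literature.NumberTheory.EllipticCurves.KellerYin2024.charLocalLambda (∅ : Set (PadicAlgCl 3)) κ θsub w + Literature.NumberTheory.EllipticCurves.KellerYin2024.charLocalLambda (∅ : Set (PadicAlgCl 3))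 κ θquot w) := by
  intro W _ _ N _ K _ _ hO6 hRed hcell hN hK hHN hodd hEK κ hκ γ hγ 𝔭 h𝔭 he hf 𝔭' h𝔭' hne θsub θquot hpair Sf hSf
    Dsub Dquot
  haveI : (W.baseChange K).IsElliptic := inferInstanceAs (W.map (algebraMap ℚ K)).IsElliptic
  -- print ⟹ B1 at `(W, K, κ, 𝔭′)`
  have hfin := CumulativeHeegnerInclusionAtThreeB1OfPrint.stub_residualSelmerFinite_of_print hP
    CumulativeHeegnerInclusionAtThreeLineDet.stub_lineDeterminantAtThree
    CumulativeHeegnerInclusionAtThreeBadPlaces.stub_badPlacesSplitFinite W N K hO6 hRed hcell hN hK hHN κ hκ 𝔭' h𝔭'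
  obtain ⟨hT, hμ⟩ :=
    EisensteinCharacterInvariantsAtThreeAlgebraicHalf.isTorsion_and_muInvariant_eq_zero_of_residualFinite W K κ γ 𝔭'
      hfin
  haveI := XAc.module_finite κ 𝔭' (∅ : Set (HeightOneSpectrum (𝓞 K))) γ Set.finite_empty (W := W.baseChange K)
  exact ⟨inferInstance, hT, hμ, hform W N K hO6 hRed hcell hN hK hHN hodd hEK κ hκ γ 𝔭 h𝔭 he hf 𝔭' h𝔭' hne θsub
    θquot hpair Sf hSf Dsub Dquot⟩

end Summit.BirchSwinnertonDyer.BirchSwinnertonDyer.Theorems.EisensteinCharacterInvariantsAtThreeAlgSplit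

end
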